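import Summits.BirchSwinnertonDyer.BirchSwinnertonDyer.Theorems.AdditiveKolyvaginRoadManinFrameResidueProperRTameTwistPlusCharacter
import Summits.BirchSwinnertonDyer.BirchSwinnertonDyer.Theorems.AdditiveKolyvaginRoadManinFrameResidueProperRTameTwistFullEuler
import HarnessLib

/-!
# Route `AdditiveKolyvaginRoad`, crux `ManinFrameResidueProperR` (stmt-BirchSwinnertonDyer-20709), line
# `birth`, stub TDS: the FULL tame-twist lever, part 1 — one odd character with the resonant primes
# `ℓ ≡ ±a_ℓ (mod p)` handled by quadratic-residue conditions on `d′` — `--supports`, helper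

Cell `pub/bsd-wall`, seat `bsd-wall-manin-p1` g3. THEOREMS ONLY (the Literature fact
`kato_neron_isIntegral_twistedSymbolSum_of_additive` is the hypothesis `hK`). `pint_twistedSymbolSum_divL`: as
`pint_twistedSymbolSum_div4` but with NO hypothesis on `(N, a_ℓ)` beyond `a_ℓ = ±1` (`ℓ ∥ N`); instead the
auxiliary prime `d′ ≡ 3 (mod 4)` carries: `−ℓ` a square mod `d′` when `ℓ ≡ a_ℓ (mod p)`, `ℓ` a square when
`ℓ ≡ −a_ℓ (mod p)` (supplied by `…RTameTwistLegendre` from conditions on `γ`). No `sorry`; nothing is closed.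
-/

set_option autoImplicit false
set_option linter.dupNamespace false

noncomputable section

open scoped Classical MatrixGroups

open WeierstrassCurve NumberField Literature.NumberTheory.EllipticCurves
  Literature.NumberTheory.EllipticCurves.ModularForms
  Literature.NumberTheory.EllipticCurves.Rank1Residual
  Literature.NumberTheory.DiophantineGeometry IsDedekindDomain Rat.HeightOneSpectrum
  Summit.BirchSwinnertonDyer.Rank1Residual Summit.BirchSwinnertonDyer.Rank1Residual.Additive
  CongruenceSubgroup Complex

namespace Summit.BirchSwinnertonDyer.BirchSwinnertonDyer.Theorems.ManinFrameResidueProperRTameTwist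

section OneCharacterFull

variable {W : WeierstrassCurve ℚ} [W.IsElliptic] [W.IsGloballyMinimal] {N : ℕ} [NeZero N]
  {p : ℕ} [hp : Fact p.Prime]

/-- **One odd character, FULL form (no hypothesis on the multiplicative primes).** GRANTED the fact: for `W`
globally minimal, additive at `p > 7`, `E[p]` irreducible, newform `f` at a level `N` with `p² ∣ N` and
`a_ℓ = ±1` for `ℓ ∥ N`, a prime `d′ > N` with `d′ ≡ 3 (4)`, `p ∤ d′ − 1`, `r ∤ d′ − 1` (odd `r ∣ p − 1`) such
that `−ℓ` (resp. `ℓ`) is a square mod `d′` for every `ℓ ∥ N` with `ℓ ≡ a_ℓ` (resp. `ℓ ≡ −a_ℓ`) mod `p`, and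
an ODD character `χ (mod d′)`: `Σ_a χ(a){∞, a/d′}_f / (|Ω⁻(W)| i)` is `p`-integral. The resonant Euler
factors are units by `…RTameTwistFullEuler` (`χ(ℓ) ≠ 1` as `χ(−ℓ) = χ(y)²`, `χ(−1) = −1`, `(χ y)^{d′−1} = 1`
with `(d′−1)/2` odd; resp. `χ(ℓ)^{(d′−1)/2} = 1`). [cite: Kato2004Asterisque, Thm. 9.7 (p. 189)]
[cite: KimNakamura2020, Cor. 2.4] -/
theorem pint_twistedSymbolSum_divL (hK : kato_neron_isIntegral_twistedSymbolSum_of_additive)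
    (hp7 : 7 < p) (hadd : Addv W p) (hirr : Irr W p) (f : CuspForm (Gamma0 N) 2) (hf : IsNewformOf W f)
    (hpN : p ^ 2 ∣ N)
    (ha : ∀ ℓ ∈ N.primeFactors, ¬ ℓ ^ 2 ∣ N → W.LFunction ℓ = 1 ∨ W.LFunction ℓ = -1)
    {d' : ℕ} (hd' : d'.Prime) (hNd' : N < d') (hpd' : ¬ p ∣ d' - 1)
    (hrd' : ∀ r : ℕ, r.Prime → r ≠ 2 → r ∣ p - 1 → ¬ r ∣ d' - 1) (h4d' : ¬ 4 ∣ d' - 1)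
    (hL : ∀ ℓ ∈ N.primeFactors, ¬ ℓ ^ 2 ∣ N →
      (((ℓ : ZMod p) / (W.LFunction ℓ : ZMod p) = 1 → IsSquare (-((ℓ : ZMod d')))) ∧
        ((ℓ : ZMod p) / (W.LFunction ℓ : ZMod p) = -1 → IsSquare ((ℓ : ZMod d')))))
    {ϖ : ℚ} (hϖ : (ϖ : ℝ) * W.imaginaryPeriodRat = minusPeriod f)
    (χ : DirichletCharacter ℂ d') (hχ : χ.Odd) :
    haveI : NeZero d' := ⟨hd'.ne_zero⟩
    ∃ s : ℕ, ¬ p ∣ s ∧ IsIntegral ℤ ((s : ℂ) *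
      (twistedSymbolSum f χ / ((W.imaginaryPeriodRat : ℂ) * I))) := by
  haveI : NeZero d' := ⟨hd'.ne_zero⟩
  haveI : Fact d'.Prime := ⟨hd'⟩
  have hpP : p.Prime := hp.out
  have hN0 : N ≠ 0 := NeZero.ne N
  -- `χ ≠ 1`, primitive, of order prime to `p`
  have hχ1 : χ ≠ 1 := by
    intro h
    have h1 : χ (-1) = -1 := hχ
    rw [h, MulChar.one_apply (isUnit_one.neg)] at h1
    norm_num at h1
  have hprim : χ.IsPrimitive := by
    rw [DirichletCharacter.isPrimitive_def]
    rcases (Nat.dvd_prime hd').mp (DirichletCharacter.conductor_dvd_level χ) with h | h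
    · exact absurd (DirichletCharacter.eq_one_iff_conductor_eq_one.mpr h) hχ1
    · exact h
  have hord : ¬ p ∣ orderOf χ := by
    intro h
    have h1 : orderOf χ ∣ Fintype.card (DirichletCharacter ℂ d') := orderOf_dvd_card
    have h2 : Fintype.card (DirichletCharacter ℂ d') = d'.totient := by
      rw [← Nat.card_eq_fintype_card]
      exact DirichletCharacter.card_eq_totient_of_hasEnoughRootsOfUnity ℂ d'
    rw [h2, Nat.totient_prime hd'] at h1
    exact hpd' (h.trans h1)
  have hpd'ne : p ≠ d' := by
    rintro rfl
    exact absurd (Nat.le_of_dvd (Nat.pos_of_ne_zero hN0) ((dvd_pow_self p two_ne_zero).trans hpN))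
      (not_le.mpr hNd')
  have hm : d'.Coprime (p * N) := Nat.Coprime.mul_right ((Nat.coprime_primes hd' hpP).mpr hpd'ne.symm)
    ((hd'.coprime_iff_not_dvd).mpr fun h ↦ absurd (Nat.le_of_dvd (Nat.pos_of_ne_zero hN0) h)
      (not_le.mpr hNd'))
  -- the value `r` and the fact
  have hΩf : 0 < minusPeriod f := IsNewform0.minusPeriod_pos_holds hf.1 hf.coeffField_eq_bot
  have hΩ : 0 < W.imaginaryPeriodRat := W.imaginaryPeriodRat_pos
  have hϖ0 : (ϖ : ℂ) ≠ 0 := by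
    have : (ϖ : ℝ) ≠ 0 := by
      rintro h; rw [h, zero_mul] at hϖ; exact hΩf.ne' hϖ.symm
    exact_mod_cast this
  have hΩfC : ((minusPeriod f : ℝ) : ℂ) = (ϖ : ℂ) * (W.imaginaryPeriodRat : ℂ) := by
    rw [← hϖ]; push_cast; ring
  set E : ℂ := ∏ ℓ ∈ N.primeFactors with ¬ ℓ ^ 2 ∣ N,
      (((ℓ : ℂ) - (W.LFunction ℓ : ℂ) * χ (ℓ : ZMod d')) *
        ((ℓ : ℂ) - (W.LFunction ℓ : ℂ) * (χ (ℓ : ZMod d'))⁻¹)) with hEdef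
  set T : ℂ := twistedSymbolSum f χ with hTdef
  set r : ℂ := E * T / (((minusPeriod f : ℝ) : ℂ) * I) with hrdef
  have hden : ((minusPeriod f : ℝ) : ℂ) * I ≠ 0 :=
    mul_ne_zero (by exact_mod_cast hΩf.ne') I_ne_zero
  have hval : E * T = r * ((minusPeriod f : ℝ) : ℂ) * I := by
    rw [hrdef, mul_assoc, div_mul_cancel₀ _ hden]
  obtain ⟨s, hs, hint⟩ :=
    (hK W f hf p hp7 hadd.1 hadd.2 hirr d' hm χ hprim hχ1 hord ϖ r).2 hχ hϖ hval
  -- `ϖ r = E · (T / (Ω i))`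
  have hre : (ϖ : ℂ) * r = E * (T / ((W.imaginaryPeriodRat : ℂ) * I)) := by
    rw [hrdef, hΩfC]
    have hΩ0 : (W.imaginaryPeriodRat : ℂ) ≠ 0 := by exact_mod_cast hΩ.ne'
    field_simp
  have hpint : ∃ s : ℕ, ¬ p ∣ s ∧ IsIntegral ℤ ((s : ℂ) * (E * (T / ((W.imaginaryPeriodRat : ℂ) * I)))) :=
    ⟨s, hs, by rw [← hre, ← mul_assoc]; exact hint⟩
  -- cancel the `p`-unit `E`
  have hEwt : ∃ (w : ℂ) (t : ℤ), IsIntegral ℤ w ∧ E * w = t ∧ ¬ (p : ℤ) ∣ t := by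
    rw [hEdef]
    refine exists_prod_mul_eq hpP _ _ fun ℓ hℓ ↦ ?_
    obtain ⟨hℓN, hℓ2⟩ := Finset.mem_filter.mp hℓ
    have hℓp : (Nat.prime_of_mem_primeFactors hℓN) = Nat.prime_of_mem_primeFactors hℓN := rfl
    have hℓprime := Nat.prime_of_mem_primeFactors hℓN
    have hℓne : ℓ ≠ p := by
      rintro rfl; exact hℓ2 hpN
    have hℓ0 : ((ℓ : ZMod p)) ≠ 0 := by
      rw [Ne, ZMod.natCast_eq_zero_iff]
      exact fun h ↦ hℓne ((Nat.prime_dvd_prime_iff_eq hpP hℓprime).mp h).symm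
    -- `χ(ℓ)^{d′−1} = 1`
    have hℓd' : ((ℓ : ZMod d')) ≠ 0 := by
      rw [Ne, ZMod.natCast_eq_zero_iff]
      exact fun h ↦ absurd (Nat.le_of_dvd hℓprime.pos h)
        (not_le.mpr ((Nat.le_of_dvd (Nat.pos_of_ne_zero hN0) (Nat.dvd_of_mem_primeFactors hℓN)).trans_lt hNd'))
    have hζ : (χ (ℓ : ZMod d')) ^ (d' - 1) = 1 := by
      rw [← map_pow, ZMod.pow_card_sub_one_eq_one hℓd', map_one]
    -- the parity of `(d′ − 1)/2` and the three cases `u = 1`, `u = −1`, `u² ≠ 1`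
    have hd'odd : d' % 2 = 1 := (Nat.Prime.mod_two_eq_one_iff_ne_two hd').mpr (by
      rintro rfl; exact absurd hNd' (by have := Nat.le_of_dvd (Nat.pos_of_ne_zero hN0) ((dvd_pow_self p two_ne_zero).trans hpN); omega))
    have hhalf : (d' - 1) / 2 % 2 = 1 ∧ 2 * ((d' - 1) / 2) = d' - 1 := by
      rcases Nat.odd_mod_four_iff.mp hd'odd with h1 | h3
      · exfalso; apply h4d'; have := Nat.div_add_mod d' 4; omega
      · have := Nat.div_add_mod d' 4; have := Nat.div_add_mod (d' - 1) 2; omega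
    set u : ZMod p := (ℓ : ZMod p) / (W.LFunction ℓ : ZMod p) with hudef
    have haℓ := ha ℓ hℓN hℓ2
    have hyne : ∀ y : ZMod d', (χ y) ^ 2 = -1 → False := by
      intro y hy2
      by_cases hy0 : y = 0
      · rw [hy0, χ.map_nonunit not_isUnit_zero] at hy2; norm_num at hy2
      have h1 : (χ y) ^ (d' - 1) = 1 := by rw [← map_pow, ZMod.pow_card_sub_one_eq_one hy0, map_one]
      rw [← hhalf.2, pow_mul, hy2] at h1
      have hodd : Odd ((d' - 1) / 2) := Nat.odd_iff.mpr hhalf.1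
      rw [hodd.neg_one_pow] at h1
      norm_num at h1
    by_cases hu1 : u = 1
    · -- resonant case `ℓ ≡ a (mod p)`: `ζ ≠ 1` because `−ℓ` is a square and `χ` is odd
      obtain ⟨y, hy⟩ := (hL ℓ hℓN hℓ2).1 hu1
      have ha0 : ((W.LFunction ℓ : ℤ) : ZMod p) ≠ 0 := by
        intro h0; rw [hudef, h0, div_zero] at hu1; exact zero_ne_one hu1
      have hℓa : (p : ℤ) ∣ (ℓ : ℤ) - W.LFunction ℓ := by
        have : ((ℓ : ZMod p)) = (W.LFunction ℓ : ZMod p) := by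
          rw [hudef, div_eq_one_iff_eq ha0] at hu1; exact hu1
        have h := (ZMod.intCast_eq_intCast_iff_dvd_sub (W.LFunction ℓ) (ℓ : ℤ) p).mp (by simpa using this.symm)
        exact h
      have hne : (ℓ : ℤ) ≠ W.LFunction ℓ := by
        have := hℓprime.two_le; rcases haℓ with h | h <;> rw [h] <;> omega
      have hζ1 : χ (ℓ : ZMod d') ≠ 1 := by
        intro h1
        apply hyne y
        have : χ (-(ℓ : ZMod d')) = χ y * χ y := by rw [hy, map_mul]
        rw [hχ.eval_neg, h1] at this
        rw [sq, ← this]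
      have hpn : ¬ (p : ℤ) ∣ ((d' - 1 : ℕ) : ℤ) := fun h ↦ hpd' (by exact_mod_cast h)
      exact exists_symmEulerFactor_mul_eq_of_modEq ℓ (W.LFunction ℓ) hℓa
        (fun h ↦ ha0 ((ZMod.intCast_zmod_eq_zero_iff_dvd _ p).mpr h)) hne
        (Nat.sub_pos_of_lt hd'.one_lt) hpn hζ hζ1
    · by_cases hu2 : u = -1
      · -- resonant case `ℓ ≡ −a (mod p)`: `ℓ` is a square, so `ζ^{(d′−1)/2} = 1` with `(d′−1)/2` odd
        obtain ⟨y, hy⟩ := (hL ℓ hℓN hℓ2).2 hu2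
        have hy0 : y ≠ 0 := by rintro rfl; exact hℓd' (by rw [hy]; ring)
        have hζ2 : (χ (ℓ : ZMod d')) ^ ((d' - 1) / 2) = 1 := by
          rw [hy, map_mul, ← sq, ← pow_mul, hhalf.2, ← map_pow, ZMod.pow_card_sub_one_eq_one hy0, map_one]
        exact exists_symmEulerFactor_mul_eq_of_oddOrder ℓ (W.LFunction ℓ) hℓ0 hu1
          (by omega) (by omega) (fun r hr hr2 hrp h ↦ hrd' r hr hr2 hrp (h.trans ⟨2, by omega⟩)) hζ2
      · -- generic case `u² ≠ 1`
        have hA : u ^ 2 ≠ 1 := by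
          intro h
          have : (u - 1) * (u + 1) = 0 := by linear_combination h
          rcases mul_eq_zero.mp this with h | h
          · exact hu1 (sub_eq_zero.mp h)
          · exact hu2 (eq_neg_of_add_eq_zero_left h)
        exact exists_symmEulerFactor_mul_eq_of_sq_ne_one ℓ (W.LFunction ℓ) hℓ0 hA
          (Nat.sub_pos_of_lt hd'.one_lt) hrd' h4d' hζ
  obtain ⟨w, t, hw, hEw, ht⟩ := hEwt
  exact pint_of_pint_mul_of_mul_eq hpP hw hEw ht hpint


end OneCharacterFull

end Summit.BirchSwinnertonDyer.BirchSwinnertonDyer.Theorems.ManinFrameResidueProperRTameTwist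

end
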